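import Summits.AnomalousDissipation.AnomalousDissipation.Theses.TameRoughRigidity
import Summits.AnomalousDissipation.AnomalousDissipation.Theorems.EnsembleRigidityDefs
import Summits.AnomalousDissipation.AnomalousDissipation.Theorems.TameRoughRigidityGPEulerCoerciveStubFloorDuality
import Summits.AnomalousDissipation.AnomalousDissipation.Theorems.TameRoughRigidityGPEulerCoerciveStubGalerkinTail
import Summits.AnomalousDissipation.AnomalousDissipation.Theorems.TameRoughRigidityGPEulerCoerciveStubGalerkinTailLocal
import HarnessLib

/-!
# Reduction of the crux `TameRoughRigidity.GPEulerCoercive` (stmt-AnomalousDissipation-18400) to the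
  Galerkin certificate ladder — line `floor_duality_galerkin`, tools stub `stub_galerkinLadderReduction`

The crux N = `GPEulerCoercive`: no Borel probability measure on `H = L²_σ(T³)` is a stationary
statistical solution (Foias–Manley–Rosa–Temam class) of the EULER equations forced by the
Galloway–Proctor force `f_GP = sin(2πx₂)e₀ + sin(2πx₀)e₁ + sin(2πx₁)e₂`.

This file records, sorry-free, the REDUCTION achieved by the line `floor_duality_galerkin`
(`Cruxes/GPEulerCoercive/Lines/floor_duality_galerkin.lean`): N follows from the GALERKIN CERTIFICATE
LADDER of `f_GP` — for every level `Γ` a resolution `M`, a strain budget `0 ≤ S < λ_M = 4π²(M²+1)` and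
a cylindrical test functional `Ψ` reading only `galerkinSpace M`, with differentials of pointwise
strain `≤ S`, such that the finite-dimensional Lyapunov-type inequality

  `Γ + S²|y|²/(λ_M − S) ≤ ‖∇y‖² + ⟨f_GP − B(y,y), Ψ'(y)⟩`   for all `y ∈ H ∩ galerkinSpace M`

holds (the hypothesis `hL` below is that ladder, verbatim the conclusion of the open stub
`stub_galerkinLadderLocal` quantified over all levels, with its STATE-DEPENDENT strain budget
`S : H → [0, λ_M)`; the global-budget version `gpEulerCoercive_of_galerkinLadder`, matching the first
shape L/T of the line, is recorded too). The closed stubs of the line do the work: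

* T `stub_galerkinTail` / T′ `stub_galerkinTailLocal` (landed, `…StubGalerkinTail(Local).lean`): the
  Galerkin certificate lifts to the floor certificate `Γ ≤ ‖∇v‖² + ⟨f − B(v,v), Ψ'(v)⟩` at EVERY
  finite-enstrophy `v ∈ H` (spectral Pythagoras, tail gap `‖∇z‖² ≥ λ_M|z|²`, polarised strain bound,
  optimisation in `|z|`; T′ pays only the strain of the one field `Ψ'(P_M v)`);
* W `stub_floorDuality` (landed, `…StubFloorDuality.lean`): a floor certificate integrates against any
  stationary Euler statistics `μ` of `f` to `Γ ≤ ensembleEnstrophy μ` (generator integral `0`,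
  enstrophy density a.e. finite).

Given an Euler statistics `μ` of `f_GP` with (finite) mean enstrophy `G`, the rung `Γ = G + 1` gives
`G + 1 ≤ G`. So the open content of N along this line is exactly the ladder: "Galerkin forced Euler
cannot stay cool" (every invariant probability measure of the `M(Γ)`-truncation has mean enstrophy
`≥ Γ` up to the penalty — the necessary condition obtained by integrating the rung against it).
This is a CONDITIONAL result by design (the ladder is the hypothesis); it closes nothing by itself.

## References

* C. Foias, O. Manley, R. Rosa, R. Temam, *Navier–Stokes Equations and Turbulence* (CUP 2001),
  Ch. IV §1.2 Def. 1.3, (1.29)–(1.31).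
* I. Tobasco, D. Goluskin, C. Doering, arXiv:1705.07096 (auxiliary functionals; finite-dimensional
  duality — the shape of each rung).
* A. Bronzi, C. Mondaini, R. Rosa, arXiv:2606.12825; R. Rosa, R. Temam, arXiv:2010.06730 (minimax for
  stationary statistical solutions, `ν > 0`).
-/

-- `Summit.<Summit>.<Problem>` is the tree's mandated summit-side namespace (CONVENTIONS §2); single-conjunct summit, duplicate deliberate.
set_option linter.dupNamespace false

noncomputable section

namespace Summit.AnomalousDissipation.AnomalousDissipation.Theorems.TameRoughRigidity.GPEulerCoercive

open MeasureTheory Filter Topology UnitAddTorus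
open scoped InnerProductSpace RealInnerProductSpace ENNReal NNReal
open Literature.Analysis.FunctionSpaces Literature.Analysis.FluidPDE
open Summit.AnomalousDissipation.AnomalousDissipation.Theorems.EnsembleRigidity

/-- Local notation: real vector fields on `T³`. -/
local notation "Vec3" => (UnitAddTorus (Fin 3)) → (EuclideanSpace ℝ (Fin 3))
/-- Local notation: `L²(T³; ℝ³)`. -/
local notation "L2" => (Lp (EuclideanSpace ℝ (Fin 3)) 2 (volume : Measure (UnitAddTorus (Fin 3))))
/-- Local notation: the energy space `H`. -/
local notation "H3" => (Torus.energySpace (Fin 3))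

/-- **The reduction N ⇐ ladder.** If `f_GP` carries a Galerkin certificate at every level `Γ`
(resolution `M`, strain budget `0 ≤ S < 4π²(M²+1)`, low-mode cylindrical `Ψ` with differentials of
pointwise strain `≤ S`, and the finite-dimensional inequality
`Γ + S²|y|²/(4π²(M²+1) − S) ≤ ‖∇y‖² + ⟨f_GP − B(y,y), Ψ'(y)⟩` on `H ∩ galerkinSpace M`), then no Borel
probability measure on `H` is a stationary statistical solution of Euler forced by `f_GP`: for such a
`μ` with mean enstrophy `G < ∞`, the rung `Γ = G + 1`, lifted to all finite-enstrophy fields by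
`stub_galerkinTail` and integrated by `stub_floorDuality`, gives `G + 1 ≤ G`. [folklore] -/
theorem gpEulerCoercive_of_galerkinLadder
    (hL : ∀ f : Vec3, f = gpForce → ∀ Γ : ℝ,
      ∃ (M : ℕ) (S : ℝ) (Ψ : Torus.CylindricalTest (Fin 3)),
        (∀ (v : L2) (i : Fin Ψ.m),
          Torus.pairing v (Ψ.g i) = Torus.pairing ((Torus.galerkinProj M : L2 →L[ℝ] L2) v) (Ψ.g i)) ∧
        (∀ (v : H3) (x : UnitAddTorus (Fin 3)) (e : EuclideanSpace ℝ (Fin 3)),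
          |⟪Torus.fderiv (Ψ.grad v) x e, e⟫_ℝ| ≤ S * ‖e‖ ^ 2) ∧
        0 ≤ S ∧ S < 4 * Real.pi ^ 2 * ((M : ℝ) ^ 2 + 1) ∧
        ∀ y : H3, (y : L2) ∈ (Torus.galerkinSpace M : Submodule ℝ L2) →
          Γ + S ^ 2 * ‖y‖ ^ 2 / (4 * Real.pi ^ 2 * ((M : ℝ) ^ 2 + 1) - S) ≤
            (Torus.eGradNormSq ((y : L2) : Vec3)).toReal + Torus.nsGeneratorPairing 0 f y (Ψ.grad y)) :
    Summit.AnomalousDissipation.AnomalousDissipation.Theses.TameRoughRigidity.GPEulerCoercive := by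
  intro f hf μ hμ
  have hf' : f = gpForce := hf.trans gpForce_eq.symm
  -- the mean enstrophy is finite
  have hG : Torus.ensembleEnstrophy μ < ⊤ := hμ.enstrophy_finite
  set G : ℝ≥0∞ := Torus.ensembleEnstrophy μ with hGdef
  -- the rung at level `G.toReal + 1`
  obtain ⟨M, S, Ψ, hlow, hstrain, hS, hSM, hgal⟩ := hL f hf' (G.toReal + 1)
  -- T: a floor certificate on all finite-enstrophy fields
  have hcert := stub_galerkinTail f M (G.toReal + 1) S Ψ hlow hstrain hS hSM hgal
  -- W: integrate against `μ`
  have hW : ENNReal.ofReal (G.toReal + 1) ≤ G := stub_floorDuality f μ Ψ (G.toReal + 1) hμ hcert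
  have hGe : G = ENNReal.ofReal G.toReal := (ENNReal.ofReal_toReal hG.ne).symm
  have hW' : ENNReal.ofReal (G.toReal + 1) ≤ ENNReal.ofReal G.toReal := hW.trans hGe.le
  have h := (ENNReal.ofReal_le_ofReal_iff ENNReal.toReal_nonneg).mp hW'
  linarith

/-- **The reduction N ⇐ ladder, state-dependent budget (the registered shape).** If `f_GP` carries,
at every level `Γ`, a Galerkin certificate with a state-dependent strain budget `S : H → [0, λ_M)`
(the conclusion of the open stub `stub_galerkinLadderLocal`), then no Borel probability measure on `H`
is a stationary statistical solution of Euler forced by `f_GP` (rung `Γ = G + 1`, lifted by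
`stub_galerkinTailLocal`, integrated by `stub_floorDuality`: `G + 1 ≤ G`). [folklore] -/
theorem gpEulerCoercive_of_galerkinLadderLocal
    (hL : ∀ f : Vec3, f = gpForce → ∀ Γ : ℝ,
      ∃ (M : ℕ) (S : H3 → ℝ) (Ψ : Torus.CylindricalTest (Fin 3)),
        (∀ (v : L2) (i : Fin Ψ.m),
          Torus.pairing v (Ψ.g i) = Torus.pairing ((Torus.galerkinProj M : L2 →L[ℝ] L2) v) (Ψ.g i)) ∧
        (∀ (v : H3) (x : UnitAddTorus (Fin 3)) (e : EuclideanSpace ℝ (Fin 3)),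
          |⟪Torus.fderiv (Ψ.grad v) x e, e⟫_ℝ| ≤ S v * ‖e‖ ^ 2) ∧
        (∀ v : H3, 0 ≤ S v) ∧ (∀ v : H3, S v < 4 * Real.pi ^ 2 * ((M : ℝ) ^ 2 + 1)) ∧
        ∀ y : H3, (y : L2) ∈ (Torus.galerkinSpace M : Submodule ℝ L2) →
          Γ + S y ^ 2 * ‖y‖ ^ 2 / (4 * Real.pi ^ 2 * ((M : ℝ) ^ 2 + 1) - S y) ≤
            (Torus.eGradNormSq ((y : L2) : Vec3)).toReal + Torus.nsGeneratorPairing 0 f y (Ψ.grad y)) :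
    Summit.AnomalousDissipation.AnomalousDissipation.Theses.TameRoughRigidity.GPEulerCoercive := by
  intro f hf μ hμ
  have hf' : f = gpForce := hf.trans gpForce_eq.symm
  have hG : Torus.ensembleEnstrophy μ < ⊤ := hμ.enstrophy_finite
  set G : ℝ≥0∞ := Torus.ensembleEnstrophy μ with hGdef
  obtain ⟨M, S, Ψ, hlow, hstrain, hS, hSM, hgal⟩ := hL f hf' (G.toReal + 1)
  have hcert := stub_galerkinTailLocal f M (G.toReal + 1) S Ψ hlow hstrain hS hSM hgal
  have hW : ENNReal.ofReal (G.toReal + 1) ≤ G := stub_floorDuality f μ Ψ (G.toReal + 1) hμ hcert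
  have hGe : G = ENNReal.ofReal G.toReal := (ENNReal.ofReal_toReal hG.ne).symm
  have hW' : ENNReal.ofReal (G.toReal + 1) ≤ ENNReal.ofReal G.toReal := hW.trans hGe.le
  have h := (ENNReal.ofReal_le_ofReal_iff ENNReal.toReal_nonneg).mp hW'
  linarith

/-- **Tools stub `stub_galerkinLadderReduction`** (registered on stmt-AnomalousDissipation-18400, line
`floor_duality_galerkin`): the crux `GPEulerCoercive` follows from the Galerkin certificate ladder of
`f_GP` at all levels with state-dependent strain budget (the conclusion of the open stub
`stub_galerkinLadderLocal`, quantified over `Γ`). A conditional result recording the line's reduction;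
`gpEulerCoercive_of_galerkinLadderLocal`. [folklore] -/
theorem stub_galerkinLadderReduction :
    (∀ f : Vec3, f = gpForce → ∀ Γ : ℝ, ∃ (M : ℕ) (S : H3 → ℝ) (Ψ : Torus.CylindricalTest (Fin 3)), (∀ (v : L2) (i : Fin Ψ.m), Torus.pairing v (Ψ.g i) = Torus.pairing ((Torus.galerkinProj M : L2 →L[ℝ] L2) v) (Ψ.g i)) ∧ (∀ (v : H3) (x : UnitAddTorus (Fin 3)) (e : EuclideanSpace ℝ (Fin 3)), |⟪Torus.fderiv (Ψ.grad v) x e, e⟫_ℝ| ≤ S v * ‖e‖ ^ 2) ∧ (∀ v : H3, 0 ≤ S v) ∧ (∀ v : H3, S v < 4 * Real.pi ^ 2 * ((M : ℝ) ^ 2 + 1)) ∧ ∀ y : H3, (y : L2) ∈ (Torus.galerkinSpace M : Submodule ℝ L2) → Γ + S y ^ 2 * ‖y‖ ^ 2 / (4 * Real.pi ^ 2 * ((M : ℝ) ^ 2 + 1) - S y) ≤ (Torus.eGradNormSq ((y : L2) : Vec3)).toReal + Torus.nsGeneratorPairing 0 f y (Ψ.grad y)) → Summit.AnomalousDissipation.AnomalousDissipation.Theses.TameRoughRigidity.GPEulerCoercive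 :=
  gpEulerCoercive_of_galerkinLadderLocal

end Summit.AnomalousDissipation.AnomalousDissipation.Theorems.TameRoughRigidity.GPEulerCoercive

end
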